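import Literature.Geometry.Riemannian.ChernFieldRemainderFour
import Literature.Geometry.Riemannian.ChernGaussBonnetFour
import Literature.Geometry.Riemannian.GaussBonnet
import Literature.Geometry.Riemannian.IndexFluxLimitFour
import Literature.Geometry.Riemannian.EulerFormFour
import HarnessLib

/-!
# The Chern–Gauss–Bonnet theorem in dimension four: proof

[scope: pseudo-Riemannian/manifold]

We PROVE the named fact `chernGaussBonnet_four` (`ChernGaussBonnetFour.lean`; Besse 1987, 6.31;
Chang–Gursky–Yang 2003, (1.1)): for every compact Hausdorff second countable `C^∞` `4`-manifold
`M` modelled on `ℝ⁴` and every `C^∞` Riemannian metric `g` on `TM`,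

  `8π² χ(M) = ¼ ∫_M |W_g|² dV_g + ∫_M σ₂(A_g) dV_g`,   `χ(M) = relEuler ℤ ℤ M ∅`.

The proof is Chern's intrinsic vector-field argument (Chern 1944, §§1–2; Chern 1945, §2), in the
orientation-free form already used for surfaces in `GaussBonnet.lean`, and establishes first
Chern's own statement `∫_M Pf(Ω) dV_g = 4π² χ(M)` (`integral_eulerForm_riemannianMeasure_eq`):

1. Take a Morse function `f` (`exists_isMorse_holds`) and `Y = grad f`; its zeros are the finitely
   many critical points of `f`.
2. Off the zeros, Chern's field `X` of the unit field `u = Y/|Y|` (`chernField`,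
   `ChernFieldFour.lean`) satisfies `div X = Pf(Ω)` (`vectorDivergence_chernField`: Chern's
   `Ω = dΠ` pulled back by `u`).
3. Cut `X` off near the zeros with the transported cutoffs `χ_r` (`TransportedCutoff.lean`) and
   apply the divergence theorem: `∫ χ_r Pf(Ω) = −Σ_p ∫ dχ_r^p(X)`.
4. At a critical point `p`, in a chart, `X = −2 det L (x − c)/‖AL(x − c)‖⁴ + O(r⁻²)`
   (`exists_chernCoordField_remainder_bound`, `ChernFieldRemainderFour.lean`; `L = DŶ(c)`,
   `AᵀA = g(c)`), so the flux tends to `−4π² sign det L` with an `O(r)` error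
   (`abs_integral_fderiv_cutoff_sub_le_four`, `IndexFluxLimitFour.lean`), and
   `sign det L = (−1)^{index_p f}` (`exists_linearization_grad_four`, Milnor 1963, §6); the cutoff
   regions have measure `O(r⁴)`.
5. Hence `∫ Pf(Ω) = 4π² Σ_p (−1)^{index_p f} = 4π² χ(M)` (`SphereMorseCount.morseCount_eq_relEuler`),
   and the splitting `Pf(Ω) = ⅛|W|² + ½σ₂(A)` (`integral_eulerForm_eq_iff`, `EulerFormFour.lean`)
   gives (1.1).

## References

* S.-S. Chern, *A simple intrinsic proof of the Gauss–Bonnet formula for closed Riemannian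
  manifolds*, Ann. of Math. 45 (1944) 747–752, §§1–2. [Chern1944]
* S.-S. Chern, *On the curvatura integra in a Riemannian manifold*, Ann. of Math. 46 (1945)
  674–684, §2. [Chern1945]
* A. L. Besse, *Einstein Manifolds* (1987), 6.31. [Besse1987]
* S.-Y. A. Chang, M. J. Gursky, P. C. Yang, Publ. Math. IHÉS 98 (2003), (1.1) p. 111.
  [ChangGurskyYang2003]
* J. Milnor, *Morse theory* (1963), §6. [Milnor1963]
-/

open Bundle Set Metric Filter Function MeasureTheory Module
open ContMDiffRiemannianMetric Literature.Geometry.Lorentzian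
open Literature.Geometry.Lorentzian.MetricCoord Literature.Geometry.Lorentzian.PseudoRiemannianMetric
open Literature.Geometry.Riemannian.IndexFlux
open Literature.Topology.FourManifolds Literature.AlgebraicTopology.SingularHomology
open scoped ContDiff Manifold Topology RealInnerProductSpace Real

noncomputable section

universe u

namespace Literature.Geometry.Riemannian

/-! ### The sign of a determinant and the negative index of inertia -/

section SignDet

variable {E : Type*} [AddCommGroup E] [Module ℝ E] [FiniteDimensional ℝ E]

/-- The sign `x/|x|` is multiplicative. [folklore] -/
theorem div_abs_mul_div_abs (x y : ℝ) : x * y / |x * y| = x / |x| * (y / |y|) := by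
  rw [abs_mul, div_mul_div_comm]

/-- `x/|x| = −1` or `1` according to the sign of `x ≠ 0`. [folklore] -/
theorem div_abs_eq_ite {x : ℝ} (hx : x ≠ 0) : x / |x| = if x < 0 then -1 else 1 := by
  split_ifs with h
  · rw [abs_of_neg h, div_neg, div_self hx]
  · rw [abs_of_pos (lt_of_le_of_ne (not_lt.1 h) (Ne.symm hx)), div_self hx]

/-- The sign of a product of nonzero reals is `(−1)^{number of negative factors}`. [folklore] -/
theorem prod_div_abs_prod_eq {ι : Type*} [DecidableEq ι] (s : Finset ι) (d : ι → ℝ)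
    (hd : ∀ i ∈ s, d i ≠ 0) :
    (∏ i ∈ s, d i) / |∏ i ∈ s, d i| = (-1 : ℝ) ^ (s.filter fun i ↦ d i < 0).card := by
  induction s using Finset.induction_on with
  | empty => simp
  | insert a s has ih =>
    rw [Finset.prod_insert has, div_abs_mul_div_abs,
      ih (fun i hi ↦ hd i (Finset.mem_insert_of_mem hi)),
      div_abs_eq_ite (hd a (Finset.mem_insert_self a s)), Finset.filter_insert]
    by_cases ha : d a < 0
    · rw [if_pos ha, if_pos ha, Finset.card_insert_of_notMem (fun h ↦ has (Finset.mem_filter.1 h).1),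
        pow_succ]
      ring
    · rw [if_neg ha, if_neg ha, one_mul]

open Matrix in
/-- **Sign of the determinant versus negative index of inertia** (any dimension). Let `G` be a
symmetric positive definite bilinear form, `L` an endomorphism, and `B(v, w) = G(L v, w)` symmetric
and nondegenerate. Then `det L ≠ 0` and `det L / |det L| = (−1)^{b⁻(B)}` (in a `B`-orthogonal basis
`det[B] = ∏ B(bᵢ,bᵢ) = det L · det[G]`, `det[G] > 0`, and `b⁻(B)` counts the negative `B(bᵢ,bᵢ)` by
Sylvester's law). Milnor 1963, §6: the index of `grad f` at a nondegenerate critical point of index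
`λ` is `(−1)^λ`. [cite: Milnor1963, §6] -/
theorem det_div_abs_det_eq_neg_one_pow_sigNeg_general
    (G : LinearMap.BilinForm ℝ E) (hGs : ∀ v w, G v w = G w v) (hGp : ∀ v, v ≠ 0 → 0 < G v v)
    (L : E →ₗ[ℝ] E) {B : LinearMap.BilinForm ℝ E} (hBG : ∀ v w, B v w = G (L v) w)
    (hBs : B.IsSymm) (hBn : B.Nondegenerate) :
    LinearMap.det L ≠ 0 ∧
      LinearMap.det L / |LinearMap.det L| = (-1 : ℝ) ^ sigNeg B.toQuadraticMap := by
  classical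
  -- a `B`-orthogonal basis
  obtain ⟨b, hb⟩ := LinearMap.BilinForm.exists_orthogonal_basis (LinearMap.BilinForm.isSymm_iff.1 hBs)
  set d : Fin (finrank ℝ E) → ℝ := fun i ↦ B (b i) (b i) with hd
  -- `B = G.compLeft L`
  have hBc : B = G.compLeft L := by
    ext v w
    rw [LinearMap.BilinForm.compLeft_apply, hBG]
  -- determinants in the basis `b`
  have hdetB : (LinearMap.BilinForm.toMatrix b B).det =
      LinearMap.det L * (LinearMap.BilinForm.toMatrix b G).det := by
    rw [hBc, LinearMap.BilinForm.toMatrix_compLeft, Matrix.det_mul, Matrix.det_transpose,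
      LinearMap.det_toMatrix]
  have hdiag : LinearMap.BilinForm.toMatrix b B = Matrix.diagonal d := by
    ext i j
    rw [LinearMap.BilinForm.toMatrix_apply, Matrix.diagonal_apply]
    split_ifs with hij
    · rw [hij]
    · exact hb hij
  have hdetB' : (LinearMap.BilinForm.toMatrix b B).det = ∏ i, d i := by
    rw [hdiag, Matrix.det_diagonal]
  -- `det[G] > 0`
  have hGpos : (LinearMap.BilinForm.toMatrix b G).PosDef := by
    refine Matrix.PosDef.of_dotProduct_mulVec_pos ?_ ?_
    · ext i j
      simp only [Matrix.conjTranspose_apply, star_trivial, LinearMap.BilinForm.toMatrix_apply]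
      exact hGs _ _
    · intro x hx
      have hx' : b.equivFun.symm x ≠ 0 := fun h ↦
        hx (b.equivFun.symm.injective (by rw [h, map_zero]))
      have hq : dotProduct (star x) (LinearMap.BilinForm.toMatrix b G *ᵥ x) =
          G (b.equivFun.symm x) (b.equivFun.symm x) := by
        simp only [star_trivial, dotProduct, Matrix.mulVec, LinearMap.BilinForm.toMatrix_apply,
          Module.Basis.equivFun_symm_apply, map_sum, map_smul, LinearMap.sum_apply,
          LinearMap.smul_apply, smul_eq_mul, Finset.mul_sum]
        refine Finset.sum_congr rfl fun i _ ↦ Finset.sum_congr rfl fun j _ ↦ ?_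
        rw [hGs (b i) (b j)]
        ring
      rw [hq]
      exact hGp _ hx'
  have hdetGpos : 0 < (LinearMap.BilinForm.toMatrix b G).det := hGpos.det_pos
  -- nondegeneracy: `det[B] ≠ 0`, so every `dᵢ ≠ 0`
  have hdetB0 : (LinearMap.BilinForm.toMatrix b B).det ≠ 0 :=
    (LinearMap.BilinForm.nondegenerate_iff_det_ne_zero b).1 hBn
  have hd0 : ∀ i, d i ≠ 0 := fun i h0 ↦ hdetB0 (by
    rw [hdetB']; exact Finset.prod_eq_zero (Finset.mem_univ i) h0)
  have hdL : LinearMap.det L = (∏ i, d i) / (LinearMap.BilinForm.toMatrix b G).det := by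
    rw [eq_div_iff hdetGpos.ne', ← hdetB, hdetB']
  have hdL0 : LinearMap.det L ≠ 0 := by
    rw [hdL]
    exact div_ne_zero (Finset.prod_ne_zero_iff.2 fun i _ ↦ hd0 i) hdetGpos.ne'
  refine ⟨hdL0, ?_⟩
  -- `sigNeg B = #{i | dᵢ < 0}` (Sylvester, through the orthogonal basis `b`)
  have hassoc : QuadraticMap.associated (R := ℝ) B.toQuadraticMap = B :=
    QuadraticMap.associated_left_inverse ℝ (fun x y ↦ hBs.eq x y)
  have hortho : (QuadraticMap.associated (R := ℝ) B.toQuadraticMap).IsOrthoᵢ b := by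
    rw [hassoc]; exact hb
  have hequiv : QuadraticMap.Equivalent B.toQuadraticMap
      (QuadraticMap.weightedSumSquares ℝ fun i ↦ B.toQuadraticMap (b i)) :=
    ⟨QuadraticForm.isometryEquivWeightedSumSquares B.toQuadraticMap b hortho⟩
  have hsig : sigNeg B.toQuadraticMap = {i | d i < 0}.ncard := by
    rw [QuadraticForm.sigNeg_of_equiv_weightedSumSquares hequiv]
    rfl
  have hcard : {i | d i < 0}.ncard = (Finset.univ.filter fun i ↦ d i < 0).card := by
    rw [Set.ncard_eq_toFinset_card']
    congr 1
    ext i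
    simp
  rw [hsig, hdL, hcard, ← prod_div_abs_prod_eq Finset.univ d (fun i _ ↦ hd0 i), abs_div,
    abs_of_pos hdetGpos, div_div_div_cancel_right₀ hdetGpos.ne']

end SignDet

/-! ### The linearization of the gradient of a Morse function on a `4`-manifold -/

section Linearization

variable {N : Type*} [TopologicalSpace N] [ChartedSpace (EuclideanSpace ℝ (Fin 4)) N]
  [IsManifold (𝓡 4) ∞ N]
  (h : ContMDiffRiemannianMetric (𝓡 4) ∞ (EuclideanSpace ℝ (Fin 4))
    (TangentSpace (𝓡 4) : N → Type _))

/-- **The linearization of `grad f` at a critical point of a Morse function on a Riemannian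
`4`-manifold**: the derivative `L` at `φ p` of the chart representative of `grad f` is invertible,
and `det L / |det L| = (−1)^{index_p f}` (Milnor 1963, §6: the index of the gradient field at a
nondegenerate critical point of index `λ` is `(−1)^λ`). [cite: Milnor1963, §6] -/
theorem exists_linearization_grad_four {f : N → ℝ} (hf : IsMorse (𝓡 4) f) {p : N}
    (hp : IsMCriticalPt (𝓡 4) f p) :
    ∃ L : EuclideanSpace ℝ (Fin 4) ≃L[ℝ] EuclideanSpace ℝ (Fin 4),
      fderiv ℝ (vectorRep (𝓡 4) p (grad (ofRiemannian h) f)) (extChartAt (𝓡 4) p p) = L ∧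
      LinearMap.det (L : EuclideanSpace ℝ (Fin 4) →ₗ[ℝ] EuclideanSpace ℝ (Fin 4)) /
          |LinearMap.det (L : EuclideanSpace ℝ (Fin 4) →ₗ[ℝ] EuclideanSpace ℝ (Fin 4))| =
        (-1 : ℝ) ^ morseIndex (𝓡 4) f p := by
  set g := ofRiemannian h with hg
  set φ := extChartAt (𝓡 4) p with hφ
  set c := φ p with hc
  set L₀ := fderiv ℝ (vectorRep (𝓡 4) p (grad g f)) c with hL₀
  have hpc : φ.symm c = p := extChartAt_to_inv p
  have hps : p ∈ (chartAt (EuclideanSpace ℝ (Fin 4)) p).source := mem_chart_source _ p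
  -- the metric at `c` in the chart
  set G := metricRep (𝓡 4) g p c with hG
  have hGs : ∀ v w, G v w = G w v := fun v w ↦ by
    simp only [hG, metricRep_apply_eq_val_symmL]
    exact g.symm _ _ _
  have hGp : ∀ v, v ≠ 0 → 0 < G v v := by
    intro v hv
    simp only [hG, metricRep_apply_eq_val_symmL]
    refine h.pos _ _ fun h0 ↦ hv ?_
    have hy : φ.symm c ∈ (chartAt (EuclideanSpace ℝ (Fin 4)) p).source := by rw [hpc]; exact hps
    have := congrArg (mfderiv (𝓡 4) 𝓘(ℝ, EuclideanSpace ℝ (Fin 4)) φ (φ.symm c)) h0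
    rwa [map_zero, mfderiv_extChartAt_symmL hy v] at this
  -- the Hessian: on the boundaryless model `ℝ⁴` it is the second Fréchet derivative of `f` read
  -- in the extended chart (`HalfSpaceCharted.mhessian_apply_eq_fderiv_fderiv`,
  -- Topology/FourManifolds/ClosedAsCobordism.lean, instance `n + 1 = 4`)
  have hBG : ∀ v w, mhessian (𝓡 4) f p v w =
      (G.toLinearMap₁₂ : LinearMap.BilinForm ℝ (EuclideanSpace ℝ (Fin 4)))
        ((L₀ : EuclideanSpace ℝ (Fin 4) →ₗ[ℝ] EuclideanSpace ℝ (Fin 4)) v) w := by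
    intro v w
    rw [HalfSpaceCharted.mhessian_apply_eq_fderiv_fderiv f p v w,
      ← metricRep_fderiv_vectorRep_grad g p hf.contMDiff hp v w]
    rfl
  have hBs : (mhessian (𝓡 4) f p).IsSymm :=
    LinearMap.BilinForm.isSymm_iff.2 (mhessian_isSymm_holds (hf.contMDiff.of_le (by norm_cast)) p)
  have hBn : (mhessian (𝓡 4) f p).Nondegenerate := hf.nondegenerate hp
  obtain ⟨hdet, hsign⟩ := det_div_abs_det_eq_neg_one_pow_sigNeg_general
    (G.toLinearMap₁₂ : LinearMap.BilinForm ℝ (EuclideanSpace ℝ (Fin 4)))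
    (fun v w ↦ hGs v w) (fun v hv ↦ hGp v hv)
    (L₀ : EuclideanSpace ℝ (Fin 4) →ₗ[ℝ] EuclideanSpace ℝ (Fin 4)) hBG hBs hBn
  -- upgrade `L₀` to an equivalence
  let Le : EuclideanSpace ℝ (Fin 4) ≃ₗ[ℝ] EuclideanSpace ℝ (Fin 4) :=
    LinearMap.equivOfDetNeZero (L₀ : EuclideanSpace ℝ (Fin 4) →ₗ[ℝ] EuclideanSpace ℝ (Fin 4)) hdet
  refine ⟨Le.toContinuousLinearEquiv, ?_, ?_⟩
  · ext v
    rfl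
  · exact hsign

end Linearization

/-! ### The index flux of Chern's field at a nondegenerate zero -/

section Flux

variable {N : Type*} [TopologicalSpace N] [ChartedSpace (EuclideanSpace ℝ (Fin 4)) N]
  [IsManifold (𝓡 4) ∞ N] [T3Space N] [MeasurableSpace N] [BorelSpace N]
  (h : ContMDiffRiemannianMetric (𝓡 4) ∞ (EuclideanSpace ℝ (Fin 4))
    (TangentSpace (𝓡 4) : N → Type _))
  [(ofRiemannian h).HasLeviCivita]

set_option backward.isDefEq.respectTransparency false in
set_option maxHeartbeats 800000 in
/-- **The index flux of Chern's field.** Let `Y` be a smooth vector field on the Riemannian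
`4`-manifold `(N, h)` with a nondegenerate zero at `p` (the derivative at `φ p` of its chart
representative is the invertible map `L`), `A` a chart linearization of the metric at `p`
(`Ĝ_{φ p}(v, w) = ⟪A v, A w⟫`) and `χ_r` the transported cutoff built with `T = A ∘ L`. Then for
Chern's field `X = chernField h Y`,

  `|∫_N dχ_r(X) dμ_h + 4π² · det L / |det L|| ≤ C r`     (`0 < r < r₀`):

in the chart the integral is `∫ Dχ̂_r(X̂) √det(h_{ij}) dx`, `X̂ = −2 det L (x − c)/‖AL(x − c)‖⁴ +
O(r⁻²)` (`exists_chernCoordField_remainder_bound`), the density is `|det A| + O(‖x − c‖)`, and the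
Euclidean flux computation `abs_integral_fderiv_cutoff_sub_le_four` gives
`2π² (−2 det L) |det A|/|det(AL)| = −4π² sign det L` up to `O(r)` (Chern 1945, §2: the flux of `Π`
through a small sphere about a zero of the field is the index times the volume `8π²/... ` normalised
to `Ω`). [cite: Chern1945, §2, (14)-(17)] -/
theorem abs_integral_mvfderiv_mcutoff_chernField_add_le (p : N)
    {Y : Π y : N, TangentSpace (𝓡 4) y}
    (hY : ContMDiff (𝓡 4) ((𝓡 4).prod 𝓘(ℝ, EuclideanSpace ℝ (Fin 4))) ∞ fun y ↦
      (TotalSpace.mk' (EuclideanSpace ℝ (Fin 4)) y (Y y) : TangentBundle (𝓡 4) N))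
    (hYp : Y p = 0)
    (L : EuclideanSpace ℝ (Fin 4) ≃L[ℝ] EuclideanSpace ℝ (Fin 4))
    (hL : fderiv ℝ (vectorRep (𝓡 4) p Y) (extChartAt (𝓡 4) p p) = L)
    (A : EuclideanSpace ℝ (Fin 4) ≃L[ℝ] EuclideanSpace ℝ (Fin 4))
    (hA : ∀ v w, metricRep (𝓡 4) (ofRiemannian h) p (extChartAt (𝓡 4) p p) v w = ⟪A v, A w⟫) :
    ∃ C r₀ : ℝ, 0 < r₀ ∧
      closedBall (extChartAt (𝓡 4) p p)
          (2 * r₀ * ‖((L.trans A).symm : EuclideanSpace ℝ (Fin 4) →L[ℝ] EuclideanSpace ℝ (Fin 4))‖)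
        ⊆ (extChartAt (𝓡 4) p).target ∧
      (∀ y ∈ (extChartAt (𝓡 4) p).source, extChartAt (𝓡 4) p y ∈ ball (extChartAt (𝓡 4) p p)
        (2 * r₀ * ‖((L.trans A).symm : EuclideanSpace ℝ (Fin 4) →L[ℝ] EuclideanSpace ℝ (Fin 4))‖)
        → y ≠ p → Y y ≠ 0) ∧
      ∀ r, 0 < r → r < r₀ →
        Continuous (fun y ↦ mvfderiv (𝓡 4) (mcutoff (𝓡 4) p
              ((L.trans A : EuclideanSpace ℝ (Fin 4) ≃L[ℝ] EuclideanSpace ℝ (Fin 4)) :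
                EuclideanSpace ℝ (Fin 4) →L[ℝ] EuclideanSpace ℝ (Fin 4)) r) y
            (chernField (ofRiemannian h) Y y)) ∧
        |(∫ y, mvfderiv (𝓡 4) (mcutoff (𝓡 4) p
              ((L.trans A : EuclideanSpace ℝ (Fin 4) ≃L[ℝ] EuclideanSpace ℝ (Fin 4)) :
                EuclideanSpace ℝ (Fin 4) →L[ℝ] EuclideanSpace ℝ (Fin 4)) r) y
            (chernField (ofRiemannian h) Y y) ∂riemannianMeasure h) +
          4 * π ^ 2 * (LinearMap.det (L : EuclideanSpace ℝ (Fin 4) →ₗ[ℝ] EuclideanSpace ℝ (Fin 4)) /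
            |LinearMap.det (L : EuclideanSpace ℝ (Fin 4) →ₗ[ℝ] EuclideanSpace ℝ (Fin 4))|)|
          ≤ C * r := by
  -- notation
  set g := ofRiemannian h with hg
  set φ := extChartAt (𝓡 4) p with hφ
  set c : EuclideanSpace ℝ (Fin 4) := φ p with hc
  set T : EuclideanSpace ℝ (Fin 4) ≃L[ℝ] EuclideanSpace ℝ (Fin 4) := L.trans A with hT
  set Ĝ := metricRep (𝓡 4) g p with hĜ
  set Ŷ := vectorRep (𝓡 4) p Y with hŶ
  set X := chernField g Y with hX
  set Xr := vectorRep (𝓡 4) p X with hXr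
  set ρ : EuclideanSpace ℝ (Fin 4) → ℝ := fun e ↦ Real.sqrt (chartGramMatrix h p e).det with hρ
  set dL : ℝ := LinearMap.det (L : EuclideanSpace ℝ (Fin 4) →ₗ[ℝ] EuclideanSpace ℝ (Fin 4))
    with hdL
  set dA : ℝ := LinearMap.det (A : EuclideanSpace ℝ (Fin 4) →ₗ[ℝ] EuclideanSpace ℝ (Fin 4))
    with hdA
  have h4 : Module.finrank ℝ (EuclideanSpace ℝ (Fin 4)) = 4 := finrank_euclideanSpace_fin
  have hgR : g.IsRiemannian := isRiemannian_ofRiemannian h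
  have hct : c ∈ φ.target := mem_extChartAt_target p
  have hpc : φ.symm c = p := extChartAt_to_inv p
  have hTe : ∀ u, T u = A (L u) := fun u ↦ rfl
  -- the metric in the chart
  have hĜm : IsMetricOn Ĝ φ.target :=
    OpensChart.isMetricOn_repr (val_chartPullback_eq_metricRep g p)
  have hĜpos : ∀ e ∈ φ.target, ∀ v : EuclideanSpace ℝ (Fin 4), v ≠ 0 → 0 < Ĝ e v v :=
    fun e he v hv ↦ metricRep_pos g hgR p he v hv
  have hA' : ∀ v w, Ĝ c v w = ⟪A v, A w⟫ := hA
  -- the field in the chart, and the remainder bound near the zero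
  have hYon : ContMDiffOn (𝓡 4) ((𝓡 4).prod 𝓘(ℝ, EuclideanSpace ℝ (Fin 4))) ∞ (secTM Y)
      (chartAt (EuclideanSpace ℝ (Fin 4)) p).source := hY.contMDiffOn
  have hŶs : ContDiffOn ℝ ∞ Ŷ φ.target := contDiffOn_vectorRep p hY.contMDiffOn
  have hŶc : Ŷ c = 0 := by
    show mfderiv (𝓡 4) 𝓘(ℝ, EuclideanSpace ℝ (Fin 4)) φ (φ.symm c) (Y (φ.symm c)) = 0
    rw [hpc, hYp, map_zero]
  obtain ⟨δ, CR, hδ, hball, hq0, hXc, hR⟩ :=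
    exists_chernCoordField_remainder_bound hĜm hĜpos hct hA' hŶs hŶc hL
  -- the density in the chart: smooth, hence Lipschitz near `c`, and `ρ c = |det A|`
  have hρs : ContDiffOn ℝ ∞ ρ φ.target := contDiffOn_sqrt_det_chartGramMatrix h p
  obtain ⟨Kρ, t, ht, hρt⟩ := ((hρs.contDiffAt ((isOpen_extChartAt_target p).mem_nhds hct)).of_le
    (by exact_mod_cast le_top)).exists_lipschitzOnWith
  obtain ⟨δ', hδ', hballt⟩ := Metric.mem_nhds_iff.1 ht
  have hρc_eq : ρ c = |dA| := by
    have hq : φ.symm c ∈ (chartAt (EuclideanSpace ℝ (Fin 4)) p).source := by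
      rw [hpc]; exact mem_chart_source _ p
    have hgram : ∀ i j, chartGramMatrix h p c i j =
        ⟪A (EuclideanSpace.basisFun (Fin 4) ℝ i), A (EuclideanSpace.basisFun (Fin 4) ℝ j)⟫ := by
      intro i j
      rw [← hA', hĜ, metricRep_apply_eq_val_symmL, hg, val_ofRiemannian,
        TangentBundle.symmL_trivializationAt hq, φ.right_inv hct]
      simp only [chartGramMatrix, Matrix.of_apply, EuclideanSpace.basisFun_apply]
      rfl
    have hmat : chartGramMatrix h p c = Matrix.of fun i j ↦
        ⟪(A : EuclideanSpace ℝ (Fin 4) →ₗ[ℝ] EuclideanSpace ℝ (Fin 4))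
          (EuclideanSpace.basisFun (Fin 4) ℝ i),
          (A : EuclideanSpace ℝ (Fin 4) →ₗ[ℝ] EuclideanSpace ℝ (Fin 4))
          (EuclideanSpace.basisFun (Fin 4) ℝ j)⟫ := by
      ext i j
      rw [hgram i j, Matrix.of_apply]
      rfl
    rw [hρ, hdA]
    dsimp only
    rw [hmat, sqrt_det_gram_eq_abs_det]
  -- a common radius
  set δ₁ : ℝ := min δ δ' with hδ₁
  have hδ₁pos : 0 < δ₁ := lt_min hδ hδ'
  have hb₁ : ball c δ₁ ⊆ ball c δ := ball_subset_ball (min_le_left _ _)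
  have hb₁' : ball c δ₁ ⊆ t := (ball_subset_ball (min_le_right _ _)).trans hballt
  have hb₁t : ball c δ₁ ⊆ φ.target := hb₁.trans hball
  -- `Y ≠ 0` on the punctured ball, read in the chart
  have hYne : ∀ e ∈ ball c δ \ {c}, Y (φ.symm e) ≠ 0 := by
    intro e he hYe
    apply hq0 e he
    have hŶe : Ŷ e = 0 := by
      show mfderiv (𝓡 4) 𝓘(ℝ, EuclideanSpace ℝ (Fin 4)) φ (φ.symm e) (Y (φ.symm e)) = 0
      rw [hYe, map_zero]
    simp [hŶe]
  -- hypotheses of the Euclidean flux lemma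
  have hXreq : ∀ e ∈ ball c δ \ {c}, Xr e = chernCoordField Ĝ Ŷ e := fun e he ↦
    vectorRep_chernField g hgR p hYon ⟨e, hball he.1⟩ (hYne e he)
  have hXrc : ContinuousOn Xr (ball c δ₁ \ {c}) :=
    (hXc.mono (sdiff_subset_sdiff_left hb₁)).congr fun e he ↦
      hXreq e (sdiff_subset_sdiff_left hb₁ he)
  have hR' : ∀ e ∈ ball c δ₁ \ {c},
      ‖Xr e - ((-2 * dL) / ‖T (e - c)‖ ^ 4) • (e - c)‖ ≤ CR / ‖e - c‖ ^ 2 := by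
    intro e he
    rw [hXreq e (sdiff_subset_sdiff_left hb₁ he), hTe]
    exact hR e (sdiff_subset_sdiff_left hb₁ he)
  have hρc' : ContinuousOn ρ (ball c δ₁) := hρs.continuousOn.mono hb₁t
  have hρL : ∀ e ∈ ball c δ₁, |ρ e - ρ c| ≤ Kρ * ‖e - c‖ := by
    intro e he
    have h1 := hρt.dist_le_mul e (hb₁' he) c (hb₁' (mem_ball_self hδ₁pos))
    rwa [Real.dist_eq, dist_eq_norm] at h1
  obtain ⟨C, hC⟩ := abs_integral_fderiv_cutoff_sub_le_four h4 T c (-2 * dL) hXrc hρc' hR' hρL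
  -- the radius `r₀`
  set nT : ℝ := ‖(T.symm : EuclideanSpace ℝ (Fin 4) →L[ℝ] EuclideanSpace ℝ (Fin 4))‖ with hnT
  set r₀ : ℝ := δ₁ / (2 * (nT + 1)) with hr₀
  have hnT0 : 0 ≤ nT := norm_nonneg _
  have hr₀pos : 0 < r₀ := by positivity
  have hr₀δ : 2 * r₀ * nT < δ₁ := by
    rw [hr₀]
    have : 2 * (δ₁ / (2 * (nT + 1))) * nT = δ₁ * (nT / (nT + 1)) := by
      field_simp
    rw [this]
    have h1 : nT / (nT + 1) < 1 := by rw [div_lt_one (by positivity)]; linarith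
    calc δ₁ * (nT / (nT + 1)) < δ₁ * 1 := mul_lt_mul_of_pos_left h1 hδ₁pos
      _ = δ₁ := mul_one _
  have hclosed₀ : closedBall c (2 * r₀ * nT) ⊆ ball c δ₁ :=
    closedBall_subset_ball hr₀δ
  refine ⟨C, r₀, hr₀pos, hclosed₀.trans hb₁t, ?_, fun r hr hrr₀ ↦ ?_⟩
  · -- no other zero of `Y` in the ball
    intro y hy hyb hyp hYy
    have he : φ y ∈ ball c δ \ {c} := by
      refine ⟨hb₁ (ball_subset_ball hr₀δ.le hyb), fun he ↦ hyp ?_⟩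
      have := congrArg φ.symm (show φ y = c from he)
      rwa [φ.left_inv hy, hpc] at this
    refine hYne (φ y) he ?_
    rwa [φ.left_inv hy]
  -- the main estimate, for `0 < r < r₀`
  have hrr' : 2 * r * nT ≤ 2 * r₀ * nT := mul_le_mul_of_nonneg_right (by linarith) hnT0
  have hrδ : 2 * r * nT < δ₁ := lt_of_le_of_lt hrr' hr₀δ
  have hclosed : closedBall c (2 * r * nT) ⊆ φ.target :=
    ((closedBall_subset_closedBall hrr').trans hclosed₀).trans hb₁t
  -- the integrand and its chart representative
  set D := fderiv ℝ (cutoff (T : EuclideanSpace ℝ (Fin 4) →L[ℝ] EuclideanSpace ℝ (Fin 4)) c r)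
    with hD
  set F : EuclideanSpace ℝ (Fin 4) → ℝ := fun e ↦ D e (Xr e) with hF
  set u : N → ℝ := fun y ↦ mvfderiv (𝓡 4) (mcutoff (𝓡 4) p
    (T : EuclideanSpace ℝ (Fin 4) →L[ℝ] EuclideanSpace ℝ (Fin 4)) r) y (X y) with hu
  have hFc : Continuous F := continuous_fderiv_cutoff_apply T hr hrδ hXrc
  have huF : ∀ y ∈ φ.source, u y = F (φ y) := by
    intro y hy
    simp only [hu, hF, hD]
    rw [mvfderiv_mcutoff_apply p _ r hy]
    congr 1
    show _ = mfderiv (𝓡 4) 𝓘(ℝ, EuclideanSpace ℝ (Fin 4)) φ (φ.symm (φ y)) (X (φ.symm (φ y)))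
    rw [φ.left_inv hy]
  have hu0 : ∀ y, y ∉ mcutoffSupport (𝓡 4) p T r → u y = 0 := by
    intro y hy
    simp only [hu]
    rw [mvfderiv_mcutoff_eq_zero p T hr hclosed hy, _root_.zero_apply]
  have husupp : support u ⊆ φ.source := by
    intro y hy
    by_contra hys
    exact hy (hu0 y fun h' ↦ hys (mcutoffSupport_subset_source p T hclosed h'))
  have hucont : Continuous u := by
    rw [continuous_iff_continuousAt]
    intro y
    by_cases hys : y ∈ φ.source
    · have h1 : ContinuousAt (F ∘ φ) y :=
        hFc.continuousAt.comp (continuousAt_extChartAt' hys)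
      refine h1.congr ?_
      filter_upwards [(isOpen_extChartAt_source (I := 𝓡 4) p).mem_nhds hys] with z hz
      exact (huF z hz).symm
    · have hy : y ∉ mcutoffSupport (𝓡 4) p T r :=
        fun h' ↦ hys (mcutoffSupport_subset_source p T hclosed h')
      refine (continuousAt_const (y := (0 : ℝ))).congr ?_
      filter_upwards [(isCompact_mcutoffSupport p T hclosed).isClosed.isOpen_compl.mem_nhds hy]
        with z hz
      exact (hu0 z hz).symm
  -- change of variables to the chart
  have hF0 : ∀ e, e ∉ φ.target → F e = 0 := by
    intro e he
    simp only [hF]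
    by_cases hDe : D e = 0
    · rw [hDe, _root_.zero_apply]
    · exact absurd (hclosed (mem_closedBall_of_fderiv_cutoff_ne_zero T hr hDe)) he
  have hint : ∫ y, u y ∂riemannianMeasure h = ∫ e, F e * ρ e := by
    rw [integral_eq_integral_chart h p hucont.measurable husupp]
    have h1 : ∫ e in φ.target, ρ e • u (φ.symm e) = ∫ e in φ.target, F e * ρ e := by
      refine setIntegral_congr_fun (measurableSet_extChartAt_target p) fun e he ↦ ?_
      simp only [smul_eq_mul]
      rw [huF _ (φ.map_target he), φ.right_inv he, mul_comm]
    rw [h1]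
    exact setIntegral_eq_integral_of_forall_compl_eq_zero fun e he ↦ by rw [hF0 e he, zero_mul]
  -- the value of the principal term
  have hdL0 : dL ≠ 0 := (LinearEquiv.isUnit_det' L.toLinearEquiv).ne_zero
  have hdA0 : dA ≠ 0 := (LinearEquiv.isUnit_det' A.toLinearEquiv).ne_zero
  have hdetT : LinearMap.det (T : EuclideanSpace ℝ (Fin 4) →ₗ[ℝ] EuclideanSpace ℝ (Fin 4)) =
      dA * dL := by
    rw [hdA, hdL, ← LinearMap.det_comp]
    congr 1
  have hconst : 2 * π ^ 2 * (-2 * dL) * ρ c /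
      |LinearMap.det (T : EuclideanSpace ℝ (Fin 4) →ₗ[ℝ] EuclideanSpace ℝ (Fin 4))| =
      -(4 * π ^ 2 * (dL / |dL|)) := by
    rw [hdetT, hρc_eq, abs_mul]
    have : |dA| ≠ 0 := abs_ne_zero.2 hdA0
    field_simp
    ring
  have hmain := hC r hr hrδ
  rw [hconst, sub_neg_eq_add, Real.norm_eq_abs] at hmain
  refine ⟨hucont, ?_⟩
  show |(∫ y, u y ∂riemannianMeasure h) + 4 * π ^ 2 * (dL / |dL|)| ≤ C * r
  rwa [hint]

omit [(ofRiemannian h).HasLeviCivita] in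
/-- **The measure of the cutoff region is `O(r⁴)`.** If the density `√det(h_{ij})` is bounded by
`B` on `closedBall (φ p) R ⊆ φ.target` and `2 r ‖T⁻¹‖ ≤ R`, then
`μ_h(mcutoffSupport p T r) ≤ B · (π²/2) (2 r ‖T⁻¹‖)⁴` (chart formula for the Riemannian measure and
the volume of a Euclidean `4`-ball). [folklore] -/
theorem measureReal_mcutoffSupport_le_four (p : N)
    (T : EuclideanSpace ℝ (Fin 4) ≃L[ℝ] EuclideanSpace ℝ (Fin 4)) {r R B : ℝ} (hr : 0 ≤ r)
    (hrR : 2 * r * ‖(T.symm : EuclideanSpace ℝ (Fin 4) →L[ℝ] EuclideanSpace ℝ (Fin 4))‖ ≤ R)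
    (hR : closedBall (extChartAt (𝓡 4) p p) R ⊆ (extChartAt (𝓡 4) p).target)
    (hB : ∀ e ∈ closedBall (extChartAt (𝓡 4) p p) R,
      Real.sqrt (chartGramMatrix h p e).det ≤ B) :
    (riemannianMeasure h).real (mcutoffSupport (𝓡 4) p T r) ≤
      B * (π ^ 2 / 2 *
        (2 * r * ‖(T.symm : EuclideanSpace ℝ (Fin 4) →L[ℝ] EuclideanSpace ℝ (Fin 4))‖) ^ 4) := by
  set φ := extChartAt (𝓡 4) p with hφ
  set c : EuclideanSpace ℝ (Fin 4) := φ p with hc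
  set nT : ℝ := ‖(T.symm : EuclideanSpace ℝ (Fin 4) →L[ℝ] EuclideanSpace ℝ (Fin 4))‖ with hnT
  set K := mcutoffSupport (𝓡 4) p T r with hK
  set D := closedBall c (2 * r * nT) with hD
  have h4 : Module.finrank ℝ (EuclideanSpace ℝ (Fin 4)) = 4 := finrank_euclideanSpace_fin
  have hDR : D ⊆ closedBall c R := closedBall_subset_closedBall hrR
  have hDt : D ⊆ φ.target := hDR.trans hR
  have hKc : IsCompact K := isCompact_mcutoffSupport p T hDt
  have hKm : MeasurableSet K := hKc.isClosed.measurableSet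
  have hKs : K ⊆ φ.source := mcutoffSupport_subset_source p T hDt
  have h1 : (riemannianMeasure h).real K =
      ∫ y, K.indicator (fun _ ↦ (1 : ℝ)) y ∂riemannianMeasure h :=
    (integral_indicator_one hKm).symm
  have hmeas : Measurable (K.indicator fun _ ↦ (1 : ℝ)) := measurable_const.indicator hKm
  have hsupp : support (K.indicator fun _ ↦ (1 : ℝ)) ⊆ φ.source :=
    (support_indicator_subset).trans hKs
  have hind : ∀ e ∈ φ.target,
      K.indicator (fun _ ↦ (1 : ℝ)) (φ.symm e) = D.indicator (fun _ ↦ 1) e := by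
    intro e he
    by_cases heD : e ∈ D
    · rw [indicator_of_mem heD, indicator_of_mem]
      exact ⟨e, heD, rfl⟩
    · rw [indicator_of_notMem heD, indicator_of_notMem]
      rintro ⟨e', he', hee'⟩
      exact heD ((φ.symm.injOn (hDt he') he hee') ▸ he')
  have h3 : ∫ e in φ.target, Real.sqrt (chartGramMatrix h p e).det • K.indicator (fun _ ↦ (1 : ℝ))
      (φ.symm e) = ∫ e in D, Real.sqrt (chartGramMatrix h p e).det := by
    have : ∫ e in φ.target, Real.sqrt (chartGramMatrix h p e).det • K.indicator (fun _ ↦ (1 : ℝ))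
        (φ.symm e) =
        ∫ e in φ.target, D.indicator (fun e ↦ Real.sqrt (chartGramMatrix h p e).det) e := by
      refine setIntegral_congr_fun (measurableSet_extChartAt_target p) fun e he ↦ ?_
      rw [hind e he, smul_eq_mul]
      by_cases heD : e ∈ D
      · rw [indicator_of_mem heD, indicator_of_mem heD, mul_one]
      · rw [indicator_of_notMem heD, indicator_of_notMem heD, mul_zero]
    rw [this, setIntegral_indicator measurableSet_closedBall, inter_eq_self_of_subset_right hDt]
  rw [h1, integral_eq_integral_chart h p hmeas hsupp, h3]
  have hvol : (volume : Measure (EuclideanSpace ℝ (Fin 4))).real D = π ^ 2 / 2 * (2 * r * nT) ^ 4 :=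
    volume_real_closedBall_of_finrank_eq_four h4 c (by positivity)
  have hbound : ‖∫ e in D, Real.sqrt (chartGramMatrix h p e).det‖ ≤
      B * (volume : Measure (EuclideanSpace ℝ (Fin 4))).real D := by
    refine norm_setIntegral_le_of_norm_le_const measure_closedBall_lt_top fun e he ↦ ?_
    rw [Real.norm_eq_abs, abs_of_nonneg (Real.sqrt_nonneg _)]
    exact hB e (hDR he)
  rw [hvol] at hbound
  exact (le_abs_self _).trans ((Real.norm_eq_abs _) ▸ hbound)

end Flux

/-! ### The Morse count as a sum over the critical points -/

section MorseCount

variable {M : Type u} [TopologicalSpace M] [ChartedSpace (EuclideanSpace ℝ (Fin 4)) M]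
  [IsManifold (𝓡 4) ∞ M] [CompactSpace M] [T2Space M] [SecondCountableTopology M]

/-- **The Morse count of a closed `4`-manifold as a sum over critical points**:
`Σ_{p critical} (−1)^{index_p f} = χ(M)` (regrouping `SphereMorseCount.morseCount_eq_relEuler` by
the value of the index, which is `≤ 4`). [cite: MilnorHCobordism1965, §3 (PDF p. 21) and Thm. 7.4 (PDF p. 48)] -/
theorem sum_neg_one_pow_morseIndex_eq_relEuler_four {f : M → ℝ} (hf : IsMorse (𝓡 4) f)
    (hfin : (criticalSet (𝓡 4) f).Finite) :
    ∑ p ∈ hfin.toFinset, (-1 : ℝ) ^ morseIndex (𝓡 4) f p = (relEuler ℤ ℤ M ∅ : ℝ) := by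
  classical
  have hcount := SphereMorseCount.morseCount_eq_relEuler (n := 3) hf
  have hZ : (∑ p ∈ hfin.toFinset, (-1 : ℤ) ^ morseIndex (𝓡 4) f p) = relEuler ℤ ℤ M ∅ := by
    rw [← hcount]
    have hmaps : ∀ p ∈ hfin.toFinset, morseIndex (𝓡 4) f p ∈ Finset.range (3 + 2) := by
      intro p _
      rw [Finset.mem_range]
      have := morseIndex_le_finrank (𝓡 4) f p
      rw [finrank_euclideanSpace_fin] at this
      omega
    rw [← Finset.sum_fiberwise_of_maps_to' hmaps (fun k ↦ (-1 : ℤ) ^ k)]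
    refine Finset.sum_congr rfl fun k _ ↦ ?_
    rw [Finset.sum_const, nsmul_eq_mul, mul_comm]
    congr 1
    have hset : criticalSetOfIndex (𝓡 4) f k =
        ↑(hfin.toFinset.filter fun p ↦ morseIndex (𝓡 4) f p = k) := by
      ext p
      simp only [mem_criticalSetOfIndex, Finset.coe_filter, Set.Finite.mem_toFinset,
        mem_criticalSet, mem_setOf_eq]
    rw [hset, Set.ncard_coe_finset]
  exact_mod_cast hZ

end MorseCount

/-! ### Chern's theorem `∫ Pf(Ω) = 4π² χ` and the Chern–Gauss–Bonnet formula -/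

section ChernGaussBonnet

variable {M : Type u} [TopologicalSpace M] [ChartedSpace (EuclideanSpace ℝ (Fin 4)) M]
  [IsManifold (𝓡 4) ∞ M] [CompactSpace M] [T2Space M] [MeasurableSpace M] [BorelSpace M]

set_option backward.isDefEq.respectTransparency false in
set_option maxHeartbeats 1600000 in
/-- **Chern's Gauss–Bonnet formula in dimension four, for a Mathlib Riemannian metric**: for a
smooth `ContMDiffRiemannianMetric` `G` on a compact `4`-manifold `M` (Hausdorff, modelled on `ℝ⁴`),
`∫_M Pf(Ω) dμ_G = 4π² χ(M)` with `Pf(Ω) = eulerForm` of `ofRiemannian G`, `μ_G` the Riemannian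
measure and `χ(M) = relEuler ℤ ℤ M ∅`. Proof: Chern's vector-field route (module docstring).
[cite: Chern1944, (9) and §2] [cite: Chern1945, (19)] -/
theorem integral_eulerForm_riemannianMeasure_eq
    (G : ContMDiffRiemannianMetric (𝓡 4) ∞ (EuclideanSpace ℝ (Fin 4))
      (TangentSpace (𝓡 4) : M → Type _)) [(ofRiemannian G).HasLeviCivita] :
    ∫ x, (ofRiemannian G).eulerForm x ∂riemannianMeasure G =
      4 * π ^ 2 * (relEuler ℤ ℤ M ∅ : ℝ) := by
  classical
  letI : RiemannianBundle (fun x : M ↦ TangentSpace (𝓡 4) x) :=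
    ⟨G.toContinuousRiemannianMetric.toRiemannianMetric⟩
  haveI : SecondCountableTopology M :=
    ChartedSpace.secondCountable_of_sigmaCompact (EuclideanSpace ℝ (Fin 4)) M
  -- notation
  set g := ofRiemannian G with hg
  set μ := riemannianMeasure G with hμ
  set S := g.eulerForm with hSdef
  have h4 : finrank ℝ (EuclideanSpace ℝ (Fin 4)) = 4 := finrank_euclideanSpace_fin
  have hgR : g.IsRiemannian := isRiemannian_ofRiemannian G
  have hSc : Continuous S := g.continuous_eulerForm hgR h4
  -- ### Step 1: a Morse function, its critical points, its gradient
  obtain ⟨f, hf⟩ := exists_isMorse_holds 4 M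
  have hfs : ContMDiff (𝓡 4) 𝓘(ℝ, ℝ) ∞ f := hf.contMDiff
  have hCfin : (criticalSet (𝓡 4) f).Finite := IsMorse.finite_criticalSet_holds hf
  set C : Finset M := hCfin.toFinset with hCdef
  have hC : ∀ p, p ∈ C ↔ IsMCriticalPt (𝓡 4) f p := fun p ↦ by
    rw [hCdef, Set.Finite.mem_toFinset, mem_criticalSet]
  set Y : Π x : M, TangentSpace (𝓡 4) x := grad g f with hYdef
  have hY : ContMDiff (𝓡 4) ((𝓡 4).prod 𝓘(ℝ, EuclideanSpace ℝ (Fin 4))) ∞ fun y ↦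
      (TotalSpace.mk' (EuclideanSpace ℝ (Fin 4)) y (Y y) : TangentBundle (𝓡 4) M) :=
    contMDiff_grad g hfs
  have hYon : ∀ x : M, ContMDiffOn (𝓡 4) ((𝓡 4).prod 𝓘(ℝ, EuclideanSpace ℝ (Fin 4))) ∞ (secTM Y)
      (chartAt (EuclideanSpace ℝ (Fin 4)) x).source := fun x ↦ hY.contMDiffOn
  have hY0 : ∀ x, Y x = 0 ↔ x ∈ C := fun x ↦ by
    rw [hC, hYdef, grad_eq_zero_iff]; rfl
  set X : Π x : M, TangentSpace (𝓡 4) x := chernField g Y with hXdef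
  have hXs : ∀ x, x ∉ C → ContMDiffAt (𝓡 4) ((𝓡 4).prod 𝓘(ℝ, EuclideanSpace ℝ (Fin 4))) ∞
      (fun y ↦ (TotalSpace.mk' (EuclideanSpace ℝ (Fin 4)) y (X y) : TangentBundle (𝓡 4) M)) x :=
    fun x hx ↦ contMDiffAt_chernField g hgR (hYon x) fun h0 ↦ hx ((hY0 x).1 h0)
  have hdivX : ∀ x, x ∉ C → g.vectorDivergence X x = S x := fun x hx ↦
    vectorDivergence_chernField g hgR (hYon x) fun h0 ↦ hx ((hY0 x).1 h0)
  -- ### Step 2: the local data at each critical point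
  have hdata : ∀ p ∈ C, ∃ T : EuclideanSpace ℝ (Fin 4) ≃L[ℝ] EuclideanSpace ℝ (Fin 4),
      ∃ Cp r₀ : ℝ, 0 < r₀ ∧
      closedBall (extChartAt (𝓡 4) p p)
          (2 * r₀ * ‖(T.symm : EuclideanSpace ℝ (Fin 4) →L[ℝ] EuclideanSpace ℝ (Fin 4))‖) ⊆
        (extChartAt (𝓡 4) p).target ∧
      ∀ r, 0 < r → r < r₀ →
        Continuous (fun y ↦ mvfderiv (𝓡 4) (mcutoff (𝓡 4) p
          (T : EuclideanSpace ℝ (Fin 4) →L[ℝ] EuclideanSpace ℝ (Fin 4)) r) y (X y)) ∧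
        |(∫ y, mvfderiv (𝓡 4) (mcutoff (𝓡 4) p
            (T : EuclideanSpace ℝ (Fin 4) →L[ℝ] EuclideanSpace ℝ (Fin 4)) r) y (X y) ∂μ) +
          4 * π ^ 2 * (-1 : ℝ) ^ morseIndex (𝓡 4) f p| ≤ Cp * r := by
    intro p hp
    obtain ⟨L, hL, hsign⟩ := exists_linearization_grad_four G hf ((hC p).1 hp)
    obtain ⟨A₀, hA₀⟩ := exists_norm_eq_norm_symmL (I := 𝓡 4) p p
    obtain ⟨A, hA⟩ :=
      exists_continuousLinearEquiv_of_norm_eq_norm_symmL p p (mem_chart_source _ p) hA₀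
    have hA' : ∀ v w, metricRep (𝓡 4) g p (extChartAt (𝓡 4) p p) v w = ⟪A v, A w⟫ := by
      intro v w
      rw [hA v, hA w, inner_eq_inner_symmL_of_norm_eq p p hA₀ v w, metricRep_apply_eq_val_symmL,
        extChartAt_to_inv (I := 𝓡 4) p]
      rfl
    obtain ⟨Cp, r₀, hr₀, hcl, -, hflux⟩ :=
      abs_integral_mvfderiv_mcutoff_chernField_add_le G p hY ((hY0 p).2 hp) L hL A hA'
    refine ⟨L.trans A, Cp, r₀, hr₀, hcl, fun r hr hrr ↦ ?_⟩
    obtain ⟨hc, hb⟩ := hflux r hr hrr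
    rw [hsign] at hb
    exact ⟨hc, hb⟩
  choose! T Cst r₀ hr₀ hcl hflux using hdata
  -- bounds for the density near each critical point, and for the Euler form
  have hdens : ∀ p ∈ C, ∃ B : ℝ, 0 ≤ B ∧ ∀ e ∈ closedBall (extChartAt (𝓡 4) p p)
      (2 * r₀ p * ‖((T p).symm : EuclideanSpace ℝ (Fin 4) →L[ℝ] EuclideanSpace ℝ (Fin 4))‖),
      Real.sqrt (chartGramMatrix G p e).det ≤ B := by
    intro p hp
    obtain ⟨B, hB⟩ := (isCompact_closedBall _ _).exists_bound_of_continuousOn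
      ((contDiffOn_sqrt_det_chartGramMatrix G p).continuousOn.mono (hcl p hp))
    refine ⟨max B 0, le_max_right _ _, fun e he ↦ ?_⟩
    exact ((le_abs_self _).trans (((Real.norm_eq_abs _).symm.le).trans (hB e he))).trans
      (le_max_left _ _)
  choose! B hB0 hB using hdens
  obtain ⟨MS₀, hMS₀⟩ := isCompact_univ.exists_bound_of_continuousOn hSc.continuousOn
  set MS : ℝ := max MS₀ 0 with hMSdef
  have hMS : ∀ y, |S y| ≤ MS := fun y ↦
    ((Real.norm_eq_abs _).symm.le.trans (hMS₀ y (mem_univ _))).trans (le_max_left _ _)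
  have hMS0 : 0 ≤ MS := le_max_right _ _
  -- ### Step 3: separate the critical points and choose a common small radius
  obtain ⟨U, hU, hUdisj⟩ := hCfin.t2_separation
  have hε : ∀ p ∈ C, ∃ ε : ℝ, 0 < ε ∧
      ∀ e ∈ ball (extChartAt (𝓡 4) p p) ε, (extChartAt (𝓡 4) p).symm e ∈ U p := by
    intro p _
    have h2' : (extChartAt (𝓡 4) p).symm ⁻¹' U p ∈ 𝓝 (extChartAt (𝓡 4) p p) := by
      refine (continuousAt_extChartAt_symm p).preimage_mem_nhds ?_
      rw [extChartAt_to_inv]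
      exact (hU p).2.mem_nhds (hU p).1
    obtain ⟨ε, hε, hball⟩ := Metric.mem_nhds_iff.1 h2'
    exact ⟨ε, hε, fun e he ↦ hball he⟩
  choose! ε hε hεU using hε
  set nT : M → ℝ := fun p ↦
    ‖((T p).symm : EuclideanSpace ℝ (Fin 4) →L[ℝ] EuclideanSpace ℝ (Fin 4))‖ with hnT
  have hnT0 : ∀ p, 0 ≤ nT p := fun p ↦ norm_nonneg _
  set ρr : M → ℝ := fun p ↦ min (r₀ p) (ε p / (2 * (nT p + 1))) with hρr
  have hρpos : ∀ p ∈ C, 0 < ρr p := fun p hp ↦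
    lt_min (hr₀ p hp) (div_pos (hε p hp) (by have := hnT0 p; positivity))
  obtain ⟨r₁, hr₁, hr₁1, hr₁C⟩ : ∃ r₁ : ℝ, 0 < r₁ ∧ r₁ ≤ 1 ∧ ∀ p ∈ C, r₁ ≤ ρr p := by
    refine ⟨(insert 1 (C.image ρr)).min' (Finset.insert_nonempty _ _), ?_,
      Finset.min'_le _ _ (Finset.mem_insert_self _ _),
      fun p hp ↦ Finset.min'_le _ _ (Finset.mem_insert_of_mem (Finset.mem_image_of_mem _ hp))⟩
    have hmem := (insert 1 (C.image ρr)).min'_mem (Finset.insert_nonempty _ _)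
    rcases Finset.mem_insert.1 hmem with h | h
    · rw [h]; exact one_pos
    · obtain ⟨p, hp, hpe⟩ := Finset.mem_image.1 h
      rw [← hpe]; exact hρpos p hp
  -- ### Step 4: the main estimate for `0 < r < r₁`
  set K₁ : ℝ := ∑ p ∈ C, Cst p with hK₁
  set K₂ : ℝ := MS * ∑ p ∈ C, B p * (π ^ 2 / 2 * (2 * nT p) ^ 4) with hK₂
  set σ : ℝ := ∑ p ∈ C, (-1 : ℝ) ^ morseIndex (𝓡 4) f p with hσ
  have hkey : ∀ r, 0 < r → r < r₁ → |(∫ x, S x ∂μ) - 4 * π ^ 2 * σ| ≤ (K₁ + K₂) * r := by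
    intro r hr hrr₁
    -- facts at each critical point
    have hrr₀ : ∀ p ∈ C, r < r₀ p := fun p hp ↦
      (hrr₁.trans_le (hr₁C p hp)).trans_le (min_le_left _ _)
    have hrε : ∀ p ∈ C, 2 * r * nT p < ε p := by
      intro p hp
      have h1 : r < ε p / (2 * (nT p + 1)) :=
        (hrr₁.trans_le (hr₁C p hp)).trans_le (min_le_right _ _)
      rw [lt_div_iff₀ (by have := hnT0 p; positivity)] at h1
      nlinarith [hnT0 p]
    have hclr : ∀ p ∈ C, closedBall (extChartAt (𝓡 4) p p) (2 * r * nT p) ⊆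
        (extChartAt (𝓡 4) p).target := fun p hp ↦
      (closedBall_subset_closedBall (by have := hnT0 p; have := hrr₀ p hp; nlinarith)).trans
        (hcl p hp)
    have hKU : ∀ p ∈ C, mcutoffSupport (𝓡 4) p (T p) r ⊆ U p := by
      rintro p hp _ ⟨e, he, rfl⟩
      exact hεU p hp e (closedBall_subset_ball (hrε p hp) he)
    have hKdisj : ∀ p ∈ C, ∀ q ∈ C, q ≠ p → ∀ y ∈ mcutoffSupport (𝓡 4) p (T p) r,
        y ∉ mcutoffSupport (𝓡 4) q (T q) r := by
      intro p hp q hq hqp y hyp hyq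
      have hd := hUdisj ((hC p).1 hp) ((hC q).1 hq) (Ne.symm hqp)
      exact Set.disjoint_left.1 hd (hKU p hp hyp) (hKU q hq hyq)
    -- the global cutoff `χ = ∏_p χ_p`
    set m : M → M → ℝ := fun p ↦ mcutoff (𝓡 4) p
      ((T p : EuclideanSpace ℝ (Fin 4) ≃L[ℝ] EuclideanSpace ℝ (Fin 4)) :
        EuclideanSpace ℝ (Fin 4) →L[ℝ] EuclideanSpace ℝ (Fin 4)) r with hm
    set χ : M → ℝ := fun y ↦ ∏ p ∈ C, m p y with hχ
    have hms : ∀ p ∈ C, ContMDiff (𝓡 4) 𝓘(ℝ, ℝ) ∞ (m p) := fun p hp ↦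
      contMDiff_mcutoff p (T p) hr (hclr p hp)
    have hχs : ContMDiff (𝓡 4) 𝓘(ℝ, ℝ) ∞ χ := contMDiff_finsetProd hms
    have hχ0 : ∀ p ∈ C, χ =ᶠ[𝓝 p] fun _ ↦ 0 := by
      intro p hp
      filter_upwards [mcutoff_eventuallyEq_zero (I := 𝓡 4) p
        ((T p : EuclideanSpace ℝ (Fin 4) ≃L[ℝ] EuclideanSpace ℝ (Fin 4)) :
          EuclideanSpace ℝ (Fin 4) →L[ℝ] EuclideanSpace ℝ (Fin 4)) r] with y hy
      exact Finset.prod_eq_zero hp hy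
    have hχ1 : ∀ y, (∀ q ∈ C, y ∉ mcutoffSupport (𝓡 4) q (T q) r) → χ =ᶠ[𝓝 y] fun _ ↦ 1 := by
      intro y hy
      have hev : ∀ᶠ z in 𝓝 y, ∀ q ∈ C, m q z = 1 :=
        (Filter.eventually_all_finset C).2 fun q hq ↦
          mcutoff_eventuallyEq_one q (T q) hr (hclr q hq) (hy q hq)
      filter_upwards [hev] with z hz
      exact Finset.prod_eq_one hz
    have hχp : ∀ p ∈ C, ∀ y ∈ mcutoffSupport (𝓡 4) p (T p) r, χ =ᶠ[𝓝 y] m p := by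
      intro p hp y hy
      have hev : ∀ᶠ z in 𝓝 y, ∀ q ∈ C.erase p, m q z = 1 :=
        (Filter.eventually_all_finset (C.erase p)).2 fun q hq ↦
          mcutoff_eventuallyEq_one q (T q) hr (hclr q (Finset.mem_of_mem_erase hq))
            (hKdisj p hp q (Finset.mem_of_mem_erase hq) (Finset.ne_of_mem_erase hq) y hy)
      filter_upwards [hev] with z hz
      show ∏ q ∈ C, m q z = m p z
      rw [← Finset.mul_prod_erase C _ hp, Finset.prod_eq_one hz, mul_one]
    -- the fluxes `u_p = dχ_p(X)` and `dχ(X) = Σ_p u_p`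
    set uf : M → M → ℝ := fun p y ↦ mvfderiv (𝓡 4) (m p) y (X y) with huf
    have hu0 : ∀ p ∈ C, ∀ y, y ∉ mcutoffSupport (𝓡 4) p (T p) r → uf p y = 0 := by
      intro p hp y hy
      simp only [huf, hm]
      rw [mvfderiv_mcutoff_eq_zero p (T p) hr (hclr p hp) hy, _root_.zero_apply]
    have hdχ : ∀ y, mvfderiv (𝓡 4) χ y (X y) = ∑ p ∈ C, uf p y := by
      intro y
      by_cases hyK : ∃ p ∈ C, y ∈ mcutoffSupport (𝓡 4) p (T p) r
      · obtain ⟨p, hp, hyp⟩ := hyK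
        rw [mvfderiv_congr_of_eventuallyEq' (hχp p hp y hyp), Finset.sum_eq_single_of_mem p hp]
        intro q hq hqp
        exact hu0 q hq y (hKdisj p hp q hq hqp y hyp)
      · push Not at hyK
        rw [mvfderiv_congr_of_eventuallyEq' (hχ1 y hyK),
          Finset.sum_eq_zero fun q hq ↦ hu0 q hq y (hyK q hq)]
        simp [mvfderiv_real_apply, mfderiv_const]
    -- the cut-off field `W = χ X` is smooth
    have hW : ContMDiff (𝓡 4) ((𝓡 4).prod 𝓘(ℝ, EuclideanSpace ℝ (Fin 4))) ∞ fun y ↦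
        (TotalSpace.mk' (EuclideanSpace ℝ (Fin 4)) y ((χ • X) y) : TangentBundle (𝓡 4) M) := by
      intro y
      by_cases hyC : y ∈ C
      · refine (contMDiffAt_zeroSection ℝ
          (TangentSpace (𝓡 4) : M → Type _)).congr_of_eventuallyEq ?_
        filter_upwards [hχ0 y hyC] with z hz
        show TotalSpace.mk' (EuclideanSpace ℝ (Fin 4)) z (χ z • X z) = ⟨z, 0⟩
        rw [hz, zero_smul]
      · exact (hχs y).smul_section (hXs y hyC)
    -- divergence of `W`: `div W = χ Pf + Σ_p u_p`
    have hdivW : ∀ y, g.vectorDivergence (χ • X) y = χ y * S y + ∑ p ∈ C, uf p y := by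
      intro y
      by_cases hyC : y ∈ C
      · have h0 : ∀ᶠ z in 𝓝 y, (χ • X) z = 0 := by
          filter_upwards [hχ0 y hyC] with z hz
          show χ z • X z = 0
          rw [hz, zero_smul]
        have hχy : χ y = 0 := (hχ0 y hyC).self_of_nhds
        have hd0 : mvfderiv (𝓡 4) χ y (X y) = 0 := by
          rw [mvfderiv_congr_of_eventuallyEq' (hχ0 y hyC)]
          simp [mvfderiv_real_apply, mfderiv_const]
        rw [vectorDivergence_eq_zero_of_eventuallyEq_zero h0, ← hdχ y, hχy, hd0]
        ring
      · rw [vectorDivergence_smul ((hXs y hyC).mdifferentiableAt (by simp))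
          ((hχs y).mdifferentiableAt (by simp)), hdivX y hyC, hdχ y]
    -- the divergence theorem
    obtain ⟨-, hint0⟩ := integral_vectorDivergence_eq_zero G
      (hW.of_le (by exact_mod_cast (le_top : (1 : ℕ∞) ≤ ⊤)))
    have hχSc : Continuous fun y ↦ χ y * S y := hχs.continuous.mul hSc
    have hχSi : Integrable (fun y ↦ χ y * S y) μ := integrable_of_continuous G hχSc
    have hui : ∀ p ∈ C, Integrable (uf p) μ := fun p hp ↦
      integrable_of_continuous G (hflux p hp r hr (hrr₀ p hp)).1
    have hsplit : (∫ y, χ y * S y ∂μ) = -∑ p ∈ C, ∫ y, uf p y ∂μ := by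
      have h1 : ∫ y, g.vectorDivergence (χ • X) y ∂μ =
          (∫ y, χ y * S y ∂μ) + ∑ p ∈ C, ∫ y, uf p y ∂μ := by
        rw [integral_congr_ae (ae_of_all _ hdivW), integral_add hχSi (integrable_finsetSum _ hui),
          integral_finsetSum _ hui]
      rw [h1] at hint0
      linarith
    -- the flux estimate
    have hfluxsum : |(∑ p ∈ C, ∫ y, uf p y ∂μ) + 4 * π ^ 2 * σ| ≤ K₁ * r := by
      have : (∑ p ∈ C, ∫ y, uf p y ∂μ) + 4 * π ^ 2 * σ =
          ∑ p ∈ C, ((∫ y, uf p y ∂μ) + 4 * π ^ 2 * (-1 : ℝ) ^ morseIndex (𝓡 4) f p) := by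
        rw [hσ, Finset.mul_sum, ← Finset.sum_add_distrib]
      rw [this, hK₁, Finset.sum_mul]
      exact (Finset.abs_sum_le_sum_abs _ _).trans (Finset.sum_le_sum fun p hp ↦
        (hflux p hp r hr (hrr₀ p hp)).2)
    -- the cutoff error: `|∫ (1 - χ) Pf| ≤ K₂ r`
    have hχ01 : ∀ y, 0 ≤ χ y ∧ χ y ≤ 1 := fun y ↦
      ⟨Finset.prod_nonneg fun p _ ↦ mcutoff_nonneg _ _ _ _,
        Finset.prod_le_one (fun p _ ↦ mcutoff_nonneg _ _ _ _) fun p _ ↦ mcutoff_le_one _ _ _ _⟩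
    have hKm : ∀ p ∈ C, MeasurableSet (mcutoffSupport (𝓡 4) p (T p) r) := fun p hp ↦
      (isCompact_mcutoffSupport p (T p) (hclr p hp)).isClosed.measurableSet
    have herr : |(∫ y, S y ∂μ) - ∫ y, χ y * S y ∂μ| ≤ K₂ * r := by
      have hSi : Integrable S μ := integrable_of_continuous G hSc
      rw [← integral_sub hSi hχSi]
      -- pointwise bound by a sum of indicators
      set ind : M → ℝ := fun y ↦ ∑ p ∈ C, (mcutoffSupport (𝓡 4) p (T p) r).indicator
        (fun _ ↦ (1 : ℝ)) y with hind
      have hptw : ∀ y, |S y - χ y * S y| ≤ MS * ind y := by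
        intro y
        have hS : |S y| ≤ MS := hMS y
        by_cases hyK : ∃ p ∈ C, y ∈ mcutoffSupport (𝓡 4) p (T p) r
        · obtain ⟨p, hp, hyp⟩ := hyK
          have h1 : (1 : ℝ) ≤ ind y := by
            rw [hind]
            dsimp only
            rw [← Finset.add_sum_erase C _ hp, indicator_of_mem hyp]
            have : 0 ≤ ∑ q ∈ C.erase p, (mcutoffSupport (𝓡 4) q (T q) r).indicator
                (fun _ ↦ (1 : ℝ)) y :=
              Finset.sum_nonneg fun q _ ↦ indicator_nonneg (fun _ _ ↦ zero_le_one) _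
            linarith
          have h3 : |S y - χ y * S y| = (1 - χ y) * |S y| := by
            rw [show S y - χ y * S y = (1 - χ y) * S y by ring, abs_mul,
              abs_of_nonneg (by linarith [(hχ01 y).2])]
          rw [h3]
          calc (1 - χ y) * |S y| ≤ 1 * MS :=
                mul_le_mul (by linarith [(hχ01 y).1]) hS (abs_nonneg _) zero_le_one
            _ ≤ MS * ind y := by rw [one_mul]; nlinarith [hMS0, h1]
        · push Not at hyK
          have hχy : χ y = 1 := (hχ1 y hyK).self_of_nhds
          have h0 : ind y = 0 := Finset.sum_eq_zero fun q hq ↦ indicator_of_notMem (hyK q hq) _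
          rw [hχy, h0, one_mul, sub_self, abs_zero, mul_zero]
      have hindi : Integrable ind μ := by
        haveI := isFiniteMeasure_riemannianMeasure G
        exact integrable_finsetSum _ fun p hp ↦ (integrable_const (1 : ℝ)).indicator (hKm p hp)
      have hI : |∫ y, S y - χ y * S y ∂μ| ≤ ∫ y, MS * ind y ∂μ := by
        refine (abs_integral_le_integral_abs).trans (integral_mono_of_nonneg
          (ae_of_all _ fun y ↦ abs_nonneg _) (hindi.const_mul _) (ae_of_all _ hptw))
      refine hI.trans ?_
      rw [integral_const_mul]
      have hsum : ∫ y, ind y ∂μ =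
          ∑ p ∈ C, ∫ y, (mcutoffSupport (𝓡 4) p (T p) r).indicator (fun _ ↦ (1 : ℝ)) y ∂μ := by
        simp only [hind]
        haveI := isFiniteMeasure_riemannianMeasure G
        exact integral_finsetSum _ fun p hp ↦ (integrable_const (1 : ℝ)).indicator (hKm p hp)
      rw [hsum]
      have hmeas : ∀ p ∈ C,
          ∫ y, (mcutoffSupport (𝓡 4) p (T p) r).indicator (fun _ ↦ (1 : ℝ)) y ∂μ
          ≤ B p * (π ^ 2 / 2 * (2 * nT p) ^ 4) * r := by
        intro p hp
        have hio : ∫ y, (mcutoffSupport (𝓡 4) p (T p) r).indicator (fun _ ↦ (1 : ℝ)) y ∂μ =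
            μ.real (mcutoffSupport (𝓡 4) p (T p) r) :=
          integral_indicator_one (hKm p hp)
        rw [hio]
        have h1 := measureReal_mcutoffSupport_le_four G p (T p) hr.le
          (show 2 * r * nT p ≤ 2 * r₀ p * nT p by
            have := hnT0 p; have := hrr₀ p hp; nlinarith) (hcl p hp) (hB p hp)
        have hr1 : r ≤ 1 := hrr₁.le.trans hr₁1
        have hr4 : r ^ 4 ≤ r := by
          calc r ^ 4 ≤ r ^ 1 := pow_le_pow_of_le_one hr.le hr1 (by norm_num)
            _ = r := pow_one r
        calc μ.real (mcutoffSupport (𝓡 4) p (T p) r) ≤ B p * (π ^ 2 / 2 * (2 * r * nT p) ^ 4) := h1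
          _ = B p * (π ^ 2 / 2 * (2 * nT p) ^ 4) * r ^ 4 := by ring
          _ ≤ B p * (π ^ 2 / 2 * (2 * nT p) ^ 4) * r := by
              have := hB0 p hp
              have := hnT0 p
              exact mul_le_mul_of_nonneg_left hr4 (by positivity)
      rw [hK₂]
      calc MS * ∑ p ∈ C, ∫ y, (mcutoffSupport (𝓡 4) p (T p) r).indicator (fun _ ↦ (1 : ℝ)) y ∂μ
          ≤ MS * ∑ p ∈ C, B p * (π ^ 2 / 2 * (2 * nT p) ^ 4) * r :=
            mul_le_mul_of_nonneg_left (Finset.sum_le_sum fun p hp ↦ hmeas p hp) hMS0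
        _ = MS * (∑ p ∈ C, B p * (π ^ 2 / 2 * (2 * nT p) ^ 4)) * r := by
            rw [← Finset.sum_mul]; ring
    -- combine
    calc |(∫ x, S x ∂μ) - 4 * π ^ 2 * σ|
        = |((∫ y, S y ∂μ) - ∫ y, χ y * S y ∂μ) -
            ((∑ p ∈ C, ∫ y, uf p y ∂μ) + 4 * π ^ 2 * σ)| := by
          rw [hsplit]; congr 1; ring
      _ ≤ |(∫ y, S y ∂μ) - ∫ y, χ y * S y ∂μ| +
            |(∑ p ∈ C, ∫ y, uf p y ∂μ) + 4 * π ^ 2 * σ| := abs_sub _ _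
      _ ≤ K₂ * r + K₁ * r := add_le_add herr hfluxsum
      _ = (K₁ + K₂) * r := by ring
  -- ### Step 5: conclusion
  have hmainEq : (∫ x, S x ∂μ) = 4 * π ^ 2 * σ := eq_of_abs_sub_le_mul hr₁ hkey
  have hσχ : σ = (relEuler ℤ ℤ M ∅ : ℝ) := sum_neg_one_pow_morseIndex_eq_relEuler_four hf hCfin
  rw [hmainEq, hσχ]

end ChernGaussBonnet

/-! ### The named fact -/

set_option backward.isDefEq.respectTransparency false in
/-- **The Chern–Gauss–Bonnet formula in dimension four** (Besse 1987, 6.31; Chang–Gursky–Yang 2003,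
(1.1) p. 111; Chern 1944): the named fact `chernGaussBonnet_four` HOLDS — for every compact
Hausdorff second countable `C^∞` `4`-manifold `M` modelled on `ℝ⁴` and every `C^∞` Riemannian
metric `g` on `TM` with its Levi-Civita connection,
`8π² χ(M) = ¼ (∫_M |W_g|² dV_g).toReal + ∫_M σ₂(A_g) dV_g`. Proof: Chern's theorem
`∫_M Pf(Ω) dV_g = 4π² χ(M)` (`integral_eulerForm_riemannianMeasure_eq`, Chern's intrinsic
vector-field proof) and the pointwise splitting `Pf(Ω) = ⅛|W|² + ½σ₂(A)` integrated
(`integral_eulerForm_eq_iff`). [cite: Besse1987, 6.31 (p. 161)] [cite: ChangGurskyYang2003, (1.1) p. 111]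
[cite: Chern1944] -/
theorem chernGaussBonnet_four_holds : chernGaussBonnet_four := by
  intro M _ _ _ _ _ _ g _ hg
  letI : MeasurableSpace M := borel M
  haveI : BorelSpace M := ⟨rfl⟩
  have h4 : finrank ℝ (EuclideanSpace ℝ (Fin 4)) = 4 := finrank_euclideanSpace_fin
  have hgg : ofRiemannian (g.toContMDiffRiemannianMetric hg) = g := rfl
  haveI : (ofRiemannian (g.toContMDiffRiemannianMetric hg)).HasLeviCivita := ‹g.HasLeviCivita›
  have hmain := integral_eulerForm_riemannianMeasure_eq (g.toContMDiffRiemannianMetric hg)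
  exact (g.integral_eulerForm_eq_iff hg h4 (relEuler ℤ ℤ M ∅ : ℝ)).1 hmain

end Literature.Geometry.Riemannian

end
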